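import Summits.CriticalPhenomena.PercolationContinuityZ3.Theorems.PercNearOneGluingNoHeavyLowerTailSunflowerMultiPetalModuleLift
import Summits.CriticalPhenomena.PercolationContinuityZ3.Theorems.PercNearOneGluingNoHeavyLowerTailSunflowerMultiPetalModuleFlip
import Summits.CriticalPhenomena.PercolationContinuityZ3.Theorems.PercNearOneGluingNoHeavyLowerTailSunflowerMultiPetalFlipSlot
import HarnessLib
import HarnessLib.Audit

/-!
# `NoHeavyLowerTail` (crux stmt-CriticalPhenomena-4575), abstract sunflower cubic, `k` petals: CONJECTURE G (EVERY flip set) FOR EVERY STRUCTURE TILED BY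
# NON-BOTTOM MODULES — all blow-ups of the `m`-atom structure `θ_m` by arbitrary gadgets, every `m`

Support file (seat `prim-l12-p2` gen 33; `--supports stmt-CriticalPhenomena-4575`; companion of `…SunflowerMultiPetalModuleLift` (this gen, p371847: pointwise `uopLiftIneqK`,
glued lift lemmas, tiling theorem for ★ₖ), `…SunflowerMultiPetalModuleFlip` (this gen: flipped glued sums `gsumFlip` and the flipped module identity
`gsumFlip_eq_sum_pattern`) and `…SunflowerMultiPetalFlipSlot` (p368113: the offset identities `symmDiff_eq_offset_union`, `sdiff_symmDiff_eq_offset_union`; `pslack_nonneg`)).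
Everything here is PROVED; no `sorry`.  Memo: run/shared/lean/prim/prim-l12/prim-l12-p2/FINDING-g33-MODULE-LIFT.md §1.10.

THE POINT.  The pointwise lift inequalities of `…ModuleLift` hold for ANY chains `x₀ ≤ x₁` with one-petal uppers; when the blocks are first FLIPPED along a set `D`
(`gsumFlip`), the decided-spectator Gladkov rows on the right-hand side become OFFSET cube slacks — the flips of an antipodal pair of `2^{W'}` are an antipodal pair of
`2^{W'}` with the common offset `D ∖ W'` (p368113) — and stay nonnegative (`sum_powerset_kkK_flip_nonneg`).  Hence the one-, two- and three-lift lemmas hold for flipped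
glued sums (`gsumFlip_twoLift_nonneg`, `gsumFlip_le_three_mul_oneLift`, `gsumFlip_threeLift_nonneg`), the flipped module identity peels a non-bottom module for EVERY
flip set (`gsumFlip_nonneg_of_isModule_of_upper`: `0 ≤ gsumFlip (W∖M) (D∖M) ∅∅∅ → 0 ≤ gsumFlip W D ∅∅∅`), and by induction over the tiles:
* **`gsumFlip_biUnion_nonneg_of_modules`**, **`ZKflip_nonneg_of_modules_cover`**: if `univ` is a disjoint union of modules `M i` with `lab (M i) ≠ 0`, then
  `0 ≤ ZKflip D` for EVERY `D` — **Conjecture G (`FlipPartitionLemmaK`, p359567) holds for every blow-up of `θ_m` by monotone gadgets on disjoint territories, every `m`**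
  (all products with any number of colours, coloured matchings, `P_n`, disjoint unions of monochromatic clutters …).  Previously G was known in the tree only for ≤ 2 petals /
  flipped-rainbow-free structures (p368113) and by census on ≤ 6 points; on paper (memo §2) via the closed-form pattern coefficients of `θ_m` — this file needs no closed form.
-/

namespace Summit.CriticalPhenomena.PercolationContinuityZ3.Theorems.SunflowerPartition

open Finset

variable {α : Type*} [DecidableEq α]

namespace MSunflower

variable {k : ℕ} (F : MSunflower k α)

/-! ## Flipped antipodal Gladkov rows are offset cube slacks -/

/-- **Flipped antipodal Gladkov**: `0 ≤ Σ_{Y ⊆ W'} kkK (lab (Y ∆ D)) (lab ((W' ∖ Y) ∆ D))` — after the flip the antipodal pairs of `2^{W'}` are the antipodal pairs of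
`2^{W'}` with the common offset `D ∖ W'`, so the sum is the offset cube slack `pslack W' (D ∖ W') ≥ 0`. [this work] -/
theorem sum_powerset_kkK_flip_nonneg (W' D : Finset α) :
    0 ≤ ∑ Y ∈ W'.powerset, kkK k (F.lab (symmDiff Y D)) (F.lab (symmDiff (W' \ Y) D)) := by
  have hterm : ∀ Y ∈ W'.powerset, kkK k (F.lab (symmDiff Y D)) (F.lab (symmDiff (W' \ Y) D))
      = kkK k (F.lab ((D \ W') ∪ symmDiff Y (D ∩ W'))) (F.lab ((D \ W') ∪ (W' \ symmDiff Y (D ∩ W')))) := by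
    intro Y hY
    have hYW : Y ⊆ W' := mem_powerset.1 hY
    rw [symmDiff_eq_offset_union D hYW, sdiff_symmDiff_eq_offset_union D hYW]
  rw [sum_congr rfl hterm]
  have h := F.pslack_nonneg W' (D \ W')
  unfold pslack at h
  refine le_of_le_of_eq h ?_
  refine (sum_nbij' (fun T => symmDiff T (D ∩ W')) (fun T => symmDiff T (D ∩ W')) ?_ ?_ ?_ ?_ ?_).symm
  · intro T hT
    have hTW : T ⊆ W' := mem_powerset.1 hT
    exact mem_powerset.2 (symmDiff_subset_union.trans (union_subset hTW inter_subset_right))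
  · intro T hT
    have hTW : T ⊆ W' := mem_powerset.1 hT
    exact mem_powerset.2 (symmDiff_subset_union.trans (union_subset hTW inter_subset_right))
  · intro T _; exact symmDiff_symmDiff_cancel_right _ _
  · intro T _; exact symmDiff_symmDiff_cancel_right _ _
  · intro T _; rfl

/-- The flipped decided-spectator Gladkov sum with the (first-block) spectator glued: `0 ≤ Σ_{(X,Y,Z) ⊢ W} [lab (X ∆ D ∪ M) dec]·kkK (lab (Y ∆ D)) (lab (Z ∆ D))`. [this work] -/
theorem sum_partsOf_dec_kkK_flip_nonneg (W D M : Finset α) :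
    0 ≤ ∑ r ∈ partsOf W, decK k (F.lab (symmDiff r.1 D ∪ M)) * kkK k (F.lab (symmDiff r.2 D)) (F.lab (symmDiff (W \ (r.1 ∪ r.2)) D)) := by
  rw [sum_partsOf_eq_sum_powerset W (fun X Y => decK k (F.lab (symmDiff X D ∪ M)) * kkK k (F.lab (symmDiff Y D)) (F.lab (symmDiff (W \ (X ∪ Y)) D)))]
  refine sum_nonneg fun X _ => ?_
  rw [← mul_sum]
  refine mul_nonneg (by unfold decK; split_ifs <;> norm_num) ?_
  have h := F.sum_powerset_kkK_flip_nonneg (W \ X) D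
  refine le_of_le_of_eq h (sum_congr rfl fun Y _ => ?_)
  rw [sdiff_sdiff_left, sup_eq_union]

/-! ## Block symmetries of flipped glued sums -/

/-- Flipped glued sums are symmetric under swapping the first two blocks (with their glue). [this work] -/
theorem gsumFlip_swap12 (W D G₀ G₁ G₂ : Finset α) : F.gsumFlip W D G₀ G₁ G₂ = F.gsumFlip W D G₁ G₀ G₂ := by
  unfold gsumFlip
  have h : ∑ r ∈ partsOf W, s6K k (F.lab (symmDiff r.1 D ∪ G₀)) (F.lab (symmDiff r.2 D ∪ G₁)) (F.lab (symmDiff (W \ (r.1 ∪ r.2)) D ∪ G₂))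
      = ∑ r ∈ partsOf W, s6K k (F.lab (symmDiff r.2 D ∪ G₀)) (F.lab (symmDiff r.1 D ∪ G₁)) (F.lab (symmDiff (W \ (r.1 ∪ r.2)) D ∪ G₂)) :=
    sum_partsOf_swap12 W (fun a b d => s6K k (F.lab (symmDiff a D ∪ G₀)) (F.lab (symmDiff b D ∪ G₁)) (F.lab (symmDiff d D ∪ G₂)))
  rw [h]
  exact sum_congr rfl fun r _ => (s6K_swap12 k _ _ _).symm

/-- Flipped glued sums are symmetric under swapping the last two blocks (with their glue). [this work] -/
theorem gsumFlip_swap23 (W D G₀ G₁ G₂ : Finset α) : F.gsumFlip W D G₀ G₁ G₂ = F.gsumFlip W D G₀ G₂ G₁ := by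
  unfold gsumFlip
  have h : ∑ r ∈ partsOf W, s6K k (F.lab (symmDiff r.1 D ∪ G₀)) (F.lab (symmDiff r.2 D ∪ G₁)) (F.lab (symmDiff (W \ (r.1 ∪ r.2)) D ∪ G₂))
      = ∑ r ∈ partsOf W, s6K k (F.lab (symmDiff r.1 D ∪ G₀)) (F.lab (symmDiff (W \ (r.1 ∪ r.2)) D ∪ G₁)) (F.lab (symmDiff r.2 D ∪ G₂)) :=
    sum_partsOf_swap23 W (fun a b d => s6K k (F.lab (symmDiff a D ∪ G₀)) (F.lab (symmDiff b D ∪ G₁)) (F.lab (symmDiff d D ∪ G₂)))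
  rw [h]
  exact sum_congr rfl fun r _ => (s6K_swap23 k _ _ _).symm

/-! ## The lift lemmas for flipped glued sums under the one-petal glue hypothesis -/

/-- **Flipped glued (MZₖ)**: if every glued label `lab (X ∪ M)` lies in `{0, p, ⊤}`, then `gsumFlip W D ∅ ∅ ∅ ≤ Σ` of the three one-lift flipped glued sums. [this work] -/
theorem gsumFlip_le_oneLift_sum (W D M : Finset α) (p : Fin (k + 2))
    (hup : ∀ X : Finset α, F.lab (X ∪ M) = 0 ∨ F.lab (X ∪ M) = p ∨ F.lab (X ∪ M) = Fin.last (k + 1)) :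
    F.gsumFlip W D ∅ ∅ ∅ ≤ F.gsumFlip W D M ∅ ∅ + F.gsumFlip W D ∅ M ∅ + F.gsumFlip W D ∅ ∅ M := by
  have g1 := F.sum_partsOf_dec_kkK_flip_nonneg W D M
  have g2 : 0 ≤ ∑ r ∈ partsOf W, decK k (F.lab (symmDiff r.2 D ∪ M)) * kkK k (F.lab (symmDiff r.1 D)) (F.lab (symmDiff (W \ (r.1 ∪ r.2)) D)) := by
    have h : ∑ r ∈ partsOf W, decK k (F.lab (symmDiff r.2 D ∪ M)) * kkK k (F.lab (symmDiff r.1 D)) (F.lab (symmDiff (W \ (r.1 ∪ r.2)) D))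
        = ∑ r ∈ partsOf W, decK k (F.lab (symmDiff r.1 D ∪ M)) * kkK k (F.lab (symmDiff r.2 D)) (F.lab (symmDiff (W \ (r.1 ∪ r.2)) D)) :=
      sum_partsOf_swap12 W (fun a b d => decK k (F.lab (symmDiff b D ∪ M)) * kkK k (F.lab (symmDiff a D)) (F.lab (symmDiff d D)))
    rw [h]; exact g1
  have g3 : 0 ≤ ∑ r ∈ partsOf W, decK k (F.lab (symmDiff (W \ (r.1 ∪ r.2)) D ∪ M)) * kkK k (F.lab (symmDiff r.1 D)) (F.lab (symmDiff r.2 D)) := by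
    have h : ∑ r ∈ partsOf W, decK k (F.lab (symmDiff (W \ (r.1 ∪ r.2)) D ∪ M)) * kkK k (F.lab (symmDiff r.1 D)) (F.lab (symmDiff r.2 D))
        = ∑ r ∈ partsOf W, decK k (F.lab (symmDiff r.1 D ∪ M)) * kkK k (F.lab (symmDiff (W \ (r.1 ∪ r.2)) D)) (F.lab (symmDiff r.2 D)) :=
      sum_partsOf_swap13 W (fun a b d => decK k (F.lab (symmDiff d D ∪ M)) * kkK k (F.lab (symmDiff a D)) (F.lab (symmDiff b D)))
    rw [h]
    refine le_of_le_of_eq g1 (sum_congr rfl fun r _ => ?_)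
    rw [kkK_comm k (F.lab (symmDiff r.2 D))]
  unfold gsumFlip
  simp only [union_empty]
  rw [← sum_add_distrib, ← sum_add_distrib]
  have key : ∑ r ∈ partsOf W, s6K k (F.lab (symmDiff r.1 D)) (F.lab (symmDiff r.2 D)) (F.lab (symmDiff (W \ (r.1 ∪ r.2)) D))
      + ∑ r ∈ partsOf W, decK k (F.lab (symmDiff r.1 D ∪ M)) * kkK k (F.lab (symmDiff r.2 D)) (F.lab (symmDiff (W \ (r.1 ∪ r.2)) D))
      + ∑ r ∈ partsOf W, decK k (F.lab (symmDiff r.2 D ∪ M)) * kkK k (F.lab (symmDiff r.1 D)) (F.lab (symmDiff (W \ (r.1 ∪ r.2)) D))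
      + ∑ r ∈ partsOf W, decK k (F.lab (symmDiff (W \ (r.1 ∪ r.2)) D ∪ M)) * kkK k (F.lab (symmDiff r.1 D)) (F.lab (symmDiff r.2 D))
      ≤ ∑ r ∈ partsOf W, (s6K k (F.lab (symmDiff r.1 D ∪ M)) (F.lab (symmDiff r.2 D)) (F.lab (symmDiff (W \ (r.1 ∪ r.2)) D))
          + s6K k (F.lab (symmDiff r.1 D)) (F.lab (symmDiff r.2 D ∪ M)) (F.lab (symmDiff (W \ (r.1 ∪ r.2)) D))
          + s6K k (F.lab (symmDiff r.1 D)) (F.lab (symmDiff r.2 D)) (F.lab (symmDiff (W \ (r.1 ∪ r.2)) D ∪ M))) := by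
    rw [← sum_add_distrib, ← sum_add_distrib, ← sum_add_distrib]
    refine sum_le_sum fun r _ => ?_
    have := uopIneqK p _ _ _ _ _ _ (F.lab_mono (subset_union_left (s₂ := M) (s₁ := symmDiff r.1 D)))
      (F.lab_mono (subset_union_left (s₂ := M) (s₁ := symmDiff r.2 D))) (F.lab_mono (subset_union_left (s₂ := M) (s₁ := symmDiff (W \ (r.1 ∪ r.2)) D)))
      (hup _) (hup _) (hup _)
    linarith
  linarith

/-- **The flipped two-lift inequality, summed form** under the one-petal glue hypothesis. [this work] -/
theorem gsumFlip_twoLift_sum_nonneg (W D M : Finset α) (p : Fin (k + 2))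
    (hup : ∀ X : Finset α, F.lab (X ∪ M) = 0 ∨ F.lab (X ∪ M) = p ∨ F.lab (X ∪ M) = Fin.last (k + 1)) :
    0 ≤ F.gsumFlip W D M M ∅ + F.gsumFlip W D M ∅ M + F.gsumFlip W D ∅ M M := by
  have g1 := F.sum_partsOf_dec_kkK_flip_nonneg W D M
  have g2 : 0 ≤ ∑ r ∈ partsOf W, decK k (F.lab (symmDiff r.2 D ∪ M)) * kkK k (F.lab (symmDiff r.1 D)) (F.lab (symmDiff (W \ (r.1 ∪ r.2)) D)) := by
    have h : ∑ r ∈ partsOf W, decK k (F.lab (symmDiff r.2 D ∪ M)) * kkK k (F.lab (symmDiff r.1 D)) (F.lab (symmDiff (W \ (r.1 ∪ r.2)) D))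
        = ∑ r ∈ partsOf W, decK k (F.lab (symmDiff r.1 D ∪ M)) * kkK k (F.lab (symmDiff r.2 D)) (F.lab (symmDiff (W \ (r.1 ∪ r.2)) D)) :=
      sum_partsOf_swap12 W (fun a b d => decK k (F.lab (symmDiff b D ∪ M)) * kkK k (F.lab (symmDiff a D)) (F.lab (symmDiff d D)))
    rw [h]; exact g1
  have g3 : 0 ≤ ∑ r ∈ partsOf W, decK k (F.lab (symmDiff (W \ (r.1 ∪ r.2)) D ∪ M)) * kkK k (F.lab (symmDiff r.1 D)) (F.lab (symmDiff r.2 D)) := by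
    have h : ∑ r ∈ partsOf W, decK k (F.lab (symmDiff (W \ (r.1 ∪ r.2)) D ∪ M)) * kkK k (F.lab (symmDiff r.1 D)) (F.lab (symmDiff r.2 D))
        = ∑ r ∈ partsOf W, decK k (F.lab (symmDiff r.1 D ∪ M)) * kkK k (F.lab (symmDiff (W \ (r.1 ∪ r.2)) D)) (F.lab (symmDiff r.2 D)) :=
      sum_partsOf_swap13 W (fun a b d => decK k (F.lab (symmDiff d D ∪ M)) * kkK k (F.lab (symmDiff a D)) (F.lab (symmDiff b D)))
    rw [h]
    refine le_of_le_of_eq g1 (sum_congr rfl fun r _ => ?_)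
    rw [kkK_comm k (F.lab (symmDiff r.2 D))]
  unfold gsumFlip
  simp only [union_empty]
  rw [← sum_add_distrib, ← sum_add_distrib]
  have key : ∑ r ∈ partsOf W, decK k (F.lab (symmDiff r.1 D ∪ M)) * kkK k (F.lab (symmDiff r.2 D)) (F.lab (symmDiff (W \ (r.1 ∪ r.2)) D))
      + ∑ r ∈ partsOf W, decK k (F.lab (symmDiff r.2 D ∪ M)) * kkK k (F.lab (symmDiff r.1 D)) (F.lab (symmDiff (W \ (r.1 ∪ r.2)) D))
      + ∑ r ∈ partsOf W, decK k (F.lab (symmDiff (W \ (r.1 ∪ r.2)) D ∪ M)) * kkK k (F.lab (symmDiff r.1 D)) (F.lab (symmDiff r.2 D))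
      ≤ ∑ r ∈ partsOf W, (s6K k (F.lab (symmDiff r.1 D ∪ M)) (F.lab (symmDiff r.2 D ∪ M)) (F.lab (symmDiff (W \ (r.1 ∪ r.2)) D))
          + s6K k (F.lab (symmDiff r.1 D ∪ M)) (F.lab (symmDiff r.2 D)) (F.lab (symmDiff (W \ (r.1 ∪ r.2)) D ∪ M))
          + s6K k (F.lab (symmDiff r.1 D)) (F.lab (symmDiff r.2 D ∪ M)) (F.lab (symmDiff (W \ (r.1 ∪ r.2)) D ∪ M))) := by
    rw [← sum_add_distrib, ← sum_add_distrib]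
    refine sum_le_sum fun r _ => ?_
    exact (uopLiftIneqK p _ _ _ _ _ _ (F.lab_mono (subset_union_left (s₂ := M) (s₁ := symmDiff r.1 D)))
      (F.lab_mono (subset_union_left (s₂ := M) (s₁ := symmDiff r.2 D))) (F.lab_mono (subset_union_left (s₂ := M) (s₁ := symmDiff (W \ (r.1 ∪ r.2)) D)))
      (hup _) (hup _) (hup _)).1
  linarith

/-- **The flipped two-lift (FLIP) inequality**: under the one-petal glue hypothesis, `0 ≤ gsumFlip W D M M ∅` for every flip set `D`. [this work] -/
theorem gsumFlip_twoLift_nonneg (W D M : Finset α) (p : Fin (k + 2))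
    (hup : ∀ X : Finset α, F.lab (X ∪ M) = 0 ∨ F.lab (X ∪ M) = p ∨ F.lab (X ∪ M) = Fin.last (k + 1)) :
    0 ≤ F.gsumFlip W D M M ∅ := by
  have h := F.gsumFlip_twoLift_sum_nonneg W D M p hup
  rw [F.gsumFlip_swap23 W D M ∅ M, F.gsumFlip_swap12 W D ∅ M M, F.gsumFlip_swap23 W D M ∅ M] at h
  linarith

/-- **Flipped glued (MZₖ), single block**: `gsumFlip W D ∅ ∅ ∅ ≤ 3 · gsumFlip W D M ∅ ∅`. [this work] -/
theorem gsumFlip_le_three_mul_oneLift (W D M : Finset α) (p : Fin (k + 2))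
    (hup : ∀ X : Finset α, F.lab (X ∪ M) = 0 ∨ F.lab (X ∪ M) = p ∨ F.lab (X ∪ M) = Fin.last (k + 1)) :
    F.gsumFlip W D ∅ ∅ ∅ ≤ 3 * F.gsumFlip W D M ∅ ∅ := by
  have h := F.gsumFlip_le_oneLift_sum W D M p hup
  rw [F.gsumFlip_swap12 W D ∅ M ∅, F.gsumFlip_swap23 W D ∅ ∅ M, F.gsumFlip_swap12 W D ∅ M ∅] at h
  linarith

/-- **The flipped three-lift sign**: `0 ≤ gsumFlip W D M M M`. [this work] -/
theorem gsumFlip_threeLift_nonneg (W D M : Finset α) (p : Fin (k + 2))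
    (hup : ∀ X : Finset α, F.lab (X ∪ M) = 0 ∨ F.lab (X ∪ M) = p ∨ F.lab (X ∪ M) = Fin.last (k + 1)) :
    0 ≤ F.gsumFlip W D M M M := by
  unfold gsumFlip
  refine sum_nonneg fun r _ => ?_
  exact (uopLiftIneqK p _ _ _ _ _ _ (F.lab_mono (subset_union_left (s₂ := M) (s₁ := symmDiff r.1 D)))
    (F.lab_mono (subset_union_left (s₂ := M) (s₁ := symmDiff r.2 D))) (F.lab_mono (subset_union_left (s₂ := M) (s₁ := symmDiff (W \ (r.1 ∪ r.2)) D)))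
    (hup _) (hup _) (hup _)).2

/-! ## Peeling a non-bottom module for every flip set, and Conjecture G for tiled structures -/

/-- **Flipped non-bottom module reduction**: for a module `(M, g)` with `M ⊆ W` and one-petal glued labels, `0 ≤ gsumFlip (W ∖ M) (D ∖ M) ∅ ∅ ∅` implies
`0 ≤ gsumFlip W D ∅ ∅ ∅` — every flip set `D`. [this work] -/
theorem gsumFlip_nonneg_of_isModule_of_upper {M : Finset α} {g : Finset α → Bool} (hF : F.IsModule M g) {W : Finset α} (hMW : M ⊆ W)
    (p : Fin (k + 2)) (hup : ∀ X : Finset α, F.lab (X ∪ M) = 0 ∨ F.lab (X ∪ M) = p ∨ F.lab (X ∪ M) = Fin.last (k + 1))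
    (D : Finset α) (h0 : 0 ≤ F.gsumFlip (W \ M) (D \ M) ∅ ∅ ∅) : 0 ≤ F.gsumFlip W D ∅ ∅ ∅ := by
  have h1 : 0 ≤ F.gsumFlip (W \ M) (D \ M) M ∅ ∅ := by
    have := F.gsumFlip_le_three_mul_oneLift (W \ M) (D \ M) M p hup; linarith
  have h2 : 0 ≤ F.gsumFlip (W \ M) (D \ M) M M ∅ := F.gsumFlip_twoLift_nonneg (W \ M) (D \ M) M p hup
  have h3 : 0 ≤ F.gsumFlip (W \ M) (D \ M) M M M := F.gsumFlip_threeLift_nonneg (W \ M) (D \ M) M p hup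
  refine F.gsumFlip_nonneg_of_isModule hF hMW (disjoint_empty_left M) (disjoint_empty_left M) (disjoint_empty_left M) fun P => ?_
  rw [empty_union, empty_union, empty_union]
  unfold glue
  by_cases a0 : (0 : Fin 3) ∈ P <;> by_cases a1 : (1 : Fin 3) ∈ P <;> by_cases a2 : (2 : Fin 3) ∈ P <;>
    simp only [a0, a1, a2, if_true, if_false]
  · exact h3
  · exact h2
  · rw [← F.gsumFlip_swap23 (W \ M) (D \ M) M M ∅]; exact h2
  · exact h1
  · rw [F.gsumFlip_swap12 (W \ M) (D \ M) ∅ M M, ← F.gsumFlip_swap23 (W \ M) (D \ M) M M ∅]; exact h2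
  · rw [F.gsumFlip_swap12 (W \ M) (D \ M) ∅ M ∅]; exact h1
  · rw [F.gsumFlip_swap23 (W \ M) (D \ M) ∅ ∅ M, F.gsumFlip_swap12 (W \ M) (D \ M) ∅ M ∅]; exact h1
  · exact h0

/-- **Tiling theorem with flips (window form)**: if `W` is a disjoint union of modules `M i` with `lab (M i) ≠ 0`, then `0 ≤ gsumFlip W D ∅ ∅ ∅` for EVERY flip set `D`.
[this work] -/
theorem gsumFlip_biUnion_nonneg_of_modules {ι : Type*} [DecidableEq ι] (s : Finset ι) (M : ι → Finset α) (g : ι → (Finset α → Bool))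
    (hmod : ∀ i ∈ s, F.IsModule (M i) (g i)) (hlab : ∀ i ∈ s, F.lab (M i) ≠ 0)
    (hdisj : ∀ i ∈ s, ∀ j ∈ s, i ≠ j → Disjoint (M i) (M j)) :
    ∀ D : Finset α, 0 ≤ F.gsumFlip (s.biUnion M) D ∅ ∅ ∅ := by
  induction s using Finset.induction_on with
  | empty =>
    intro D
    rw [biUnion_empty, F.gsumFlip_window_empty, union_empty]
    exact le_of_eq (s6K_diag k _).symm
  | insert i s hi ih =>
    intro D
    have hmod' : ∀ j ∈ s, F.IsModule (M j) (g j) := fun j hj => hmod j (mem_insert_of_mem hj)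
    have hlab' : ∀ j ∈ s, F.lab (M j) ≠ 0 := fun j hj => hlab j (mem_insert_of_mem hj)
    have hdisj' : ∀ j ∈ s, ∀ j' ∈ s, j ≠ j' → Disjoint (M j) (M j') :=
      fun j hj j' hj' hne => hdisj j (mem_insert_of_mem hj) j' (mem_insert_of_mem hj') hne
    have hd : Disjoint (M i) (s.biUnion M) := by
      rw [disjoint_biUnion_right]
      intro j hj
      exact hdisj i (mem_insert_self i s) j (mem_insert_of_mem hj) (fun h => hi (h ▸ hj))
    have hW : (insert i s).biUnion M \ M i = s.biUnion M := by
      rw [biUnion_insert, union_sdiff_left, Finset.sdiff_eq_self_iff_disjoint]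
      exact hd.symm
    refine F.gsumFlip_nonneg_of_isModule_of_upper (hmod i (mem_insert_self i s)) ?_ (F.lab (M i))
      (fun X => F.lab_union_cases_of_lab_ne_zero (M i) X (hlab i (mem_insert_self i s))) D ?_
    · rw [biUnion_insert]; exact subset_union_left
    · rw [hW]; exact ih hmod' hlab' hdisj' (D \ M i)

/-- **CONJECTURE G FOR STRUCTURES TILED BY NON-BOTTOM MODULES** (every blow-up of the `m`-atom structure `θ_m` by monotone gadgets on pairwise disjoint territories,
every `m`): if the ground type is a disjoint union of modules `M i` with `lab (M i) ≠ 0`, then `0 ≤ ZKflip D` for EVERY flip set `D`. [this work] -/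
theorem ZKflip_nonneg_of_modules_cover [Fintype α] {ι : Type*} [DecidableEq ι] (s : Finset ι) (M : ι → Finset α) (g : ι → (Finset α → Bool))
    (hmod : ∀ i ∈ s, F.IsModule (M i) (g i)) (hlab : ∀ i ∈ s, F.lab (M i) ≠ 0)
    (hdisj : ∀ i ∈ s, ∀ j ∈ s, i ≠ j → Disjoint (M i) (M j)) (hcov : s.biUnion M = univ) (D : Finset α) : 0 ≤ F.ZKflip D := by
  rw [F.ZKflip_eq_gsumFlip, ← hcov]
  exact F.gsumFlip_biUnion_nonneg_of_modules s M g hmod hlab hdisj D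

end MSunflower

end Summit.CriticalPhenomena.PercolationContinuityZ3.Theorems.SunflowerPartition
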